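import Mathlib
import Literature.Computability.AlgebraicComplexity.StandardFamilies
import Summits.ValiantsHypothesis.ValiantsHypothesis.Theses.RefutationDegree
import Summits.ValiantsHypothesis.ValiantsHypothesis.Theorems.RefutationDegreeDefs
import Summits.ValiantsHypothesis.ValiantsHypothesis.Theorems.RefutationDegreeRefutationBarrierStubSosPaddingMono
import Summits.ValiantsHypothesis.ValiantsHypothesis.Theorems.RefutationDegreeRefutationBarrierStubNotHasSosRefOfContactSeq
import Summits.ValiantsHypothesis.ValiantsHypothesis.Theorems.RefutationDegreeRefutationBarrierContactOfBarrier

/-!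
# Crux `RefutationBarrier` (stmt-ValiantsHypothesis-5642), line `Sketch-ideator1`: the composition
(C⁺ = super-polynomial arc contact ⟹ the crux)

Lead's file.  The thesis side of line `arc-contact-exponent`, SORRY-FREE and CONDITIONAL on its
transfer target C⁺: if for every `c`, eventually in `n`, Rep(n, ⌊n²/2⌋+1) has asymptotic
pseudo-solutions of contact `n^c` (`ContactSeq`, e.g. the points of a Laurent arc of size-`(⌊n²/2⌋+1)`
affine pencils with `det A(t)(x) = per_n(x) + O(t^K)`, `K/N ≥ n^c`), then `RefutationBarrier` holds:
arcs kill bounded-degree Hermitian SOS at `m₁ = ⌊n²/2⌋+1` (stub T1, `stub_notHasSosRef_of_contactSeq`),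
and padding `A ↦ A ⊕ [1]` carries a refutation at any `m ≥ m₁` down to `m₁` (stub T0,
`stub_sosPaddingMono`, iterated).  The hypothesis C⁺ is OPEN and, by
`Theorems/RefutationDegreeRefutationBarrierConverse.lean`, would force `\overline{dc}(per_n) ≤ ⌊n²/2⌋+1`
cofinitely (modulo Skoda–Brownawell) — it is expected to be false; this file records exactly what the
line reduces the crux to, and (with `contactQP_of_refutationBarrier` of
`Theorems/RefutationDegreeRefutationBarrierContactOfBarrier.lean`) that the reduction is an EQUIVALENCE
modulo Skoda–Brownawell (`refutationBarrier_iff_contactQP`).  Vocabulary from `Theorems/RefutationDegreeDefs.lean`.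
-/

-- `Summit.ValiantsHypothesis.ValiantsHypothesis.…` is the tree's mandated single-conjunct layout
-- (Sub = Summit), so the duplicated namespace component is intended.
set_option linter.dupNamespace false

noncomputable section

namespace Summit.ValiantsHypothesis.ValiantsHypothesis.Theorems.RefutationDegree

open scoped BigOperators
open Filter Topology MvPolynomial
open Literature.RingTheory.Nullstellensatz (skodaBrownawellDegreeBound)
open Summit.ValiantsHypothesis.ValiantsHypothesis.Theses.RefutationDegree

/-- Padding, iterated: Hermitian-SOS refutations descend from size `m` to every size `m₁ ≤ m` with the
same degree budget (`stub_sosPaddingMono`). [folklore] -/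
theorem hasSosRef_anti (n : ℕ) {m₁ m : ℕ} (D : ℕ) (hle : m₁ ≤ m) :
    HasSosRef n m D → HasSosRef n m₁ D := by
  induction hle with
  | refl => exact id
  | step _ ih => exact fun hs => ih (stub_sosPaddingMono _ _ _ hs)

/-- **C⁺ ⟹ `RefutationBarrier`** (the composition of line `Sketch-ideator1`, by name): super-polynomial
arc contact at the quadratic size implies that for every `c`, for all large `n` and every
`m ≥ ⌊n²/2⌋+1`, Rep(n,m) has no Hermitian-SOS refutation with products of degree `≤ n^c`.
CONDITIONAL on the open hypothesis `hC` (expected false, see the module docstring). -/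
theorem refutationBarrier_of_contactQP
    (hC : ∀ c : ℕ, ∃ n₀ : ℕ, ∀ n ≥ n₀, ContactSeq n (n ^ 2 / 2 + 1) (n ^ c)) :
    RefutationBarrier := by
  rw [refutationBarrier_iff]
  intro c
  obtain ⟨n₀, hn₀⟩ := hC c
  refine ⟨n₀, fun n hn m hm hsos => ?_⟩
  exact stub_notHasSosRef_of_contactSeq _ _ _ (hn₀ n hn) (hasSosRef_anti n (n ^ c) hm hsos)

/-- The same at a SINGLE exponent: contact `n^c` at size `⌊n²/2⌋+1` eventually in `n` gives the
instance `c` of the barrier (useful when only bounded contact is available). -/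
theorem refutationBarrier_instance_of_contact (c : ℕ) {n₀ : ℕ}
    (hC : ∀ n ≥ n₀, ContactSeq n (n ^ 2 / 2 + 1) (n ^ c)) :
    ∀ n ≥ n₀, ∀ m : ℕ, n ^ 2 / 2 + 1 ≤ m → ¬ HasSosRef n m (n ^ c) :=
  fun n hn _m hm hsos => stub_notHasSosRef_of_contactSeq _ _ _ (hC n hn) (hasSosRef_anti n (n ^ c) hm hsos)

/-- **The crux ⟺ C⁺, modulo Skoda–Brownawell** (the card's (C1): "RefutationBarrier ⟺
κ(n, ⌊n²/2⌋+1) = n^{ω(1)}"): bounded-degree Hermitian-SOS reasoning past the Hessian bound fails for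
every polynomial degree budget EXACTLY when `per_n` osculates the size-`(⌊n²/2⌋+1)` determinantal
border to every polynomial order.  (`→`: `contactQP_of_refutationBarrier`, needs the named analytic
fact; `←`: `refutationBarrier_of_contactQP`, unconditional.) -/
theorem refutationBarrier_iff_contactQP
    (hSB : ∀ n m : ℕ, skodaBrownawellDegreeBound (σ := Unk n m) (ι := (Fin n × Fin n) →₀ ℕ)) :
    RefutationBarrier ↔ ∀ c : ℕ, ∃ n₀ : ℕ, ∀ n ≥ n₀, ContactSeq n (n ^ 2 / 2 + 1) (n ^ c) :=
  ⟨contactQP_of_refutationBarrier hSB, refutationBarrier_of_contactQP⟩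

end Summit.ValiantsHypothesis.ValiantsHypothesis.Theorems.RefutationDegree

end
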